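import Mathlib
import HarnessLib
import HarnessLib.Audit
import Summits.Langlands.Statement
import Summits.Langlands.Langlands.Theses.LieDefectSplit
import Summits.Langlands.Langlands.Theses.OdlyzkoWorldSplit
import Summits.Langlands.Langlands.Theorems.LieDefectSplit
import Summits.Langlands.Langlands.Theorems.LieDefectSplitBridge
import Literature.NumberTheory.GaloisRepresentations.ExtendedAdequateSubgroup
import Literature.NumberTheory.GaloisRepresentations.AdequateOfCoprimeOrder


/-!
# ExtendedAdequacySplit — decomp-langlands lens 5 («finite/base range + asymptotic regime + bridge»), generation 13, NODE

TARGET (RESIDUAL MODE, lineage blocker first).  DEG = `LieDefectSplit.DegenerateLayerLifting` (stmt-Langlands-28416, crux rank 3, OPEN, the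
DECLARED RESIDUAL of route-Langlands-LieDefectSplit rev 0 @1ca35fd1ea57 — the gen-12 residual of RSL 27954 = `CoreAdequacySplit.NoAdequateLayerLifting`,
itself the gen-11 residual of F† 33907).  Instances: K a number field, 0 < n, IH = Lift_w below n (`LiftBelow n`), a prime ℓ < 2(n+1),
ρ : Γ_K → GL_n(ℚ̄_ℓ) framed with ρ̄|Γ_{K(ζ_ℓ)} absolutely irreducible (CycIrr) whose image I has NO Thorne-adequate layer (¬ADQ, ¬SADQ), is off the
solvable-descent shadow (¬D↓) and has NO QUASI-adequate absolutely irreducible layer above its perfect core P (¬SQAL: on every such layer one of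
(i) Hom(J, 𝔽̄_ℓ) = 0, (ii) (ad⁰)^J = 0, (iv) eigen-spanning fails); ρ neither solvably reducible nor solvably mated; conclusion `LiftTail`
(irreducible → geometric → linked → weakly automorphic).  The landed twin `LieDefect.DegenerateLayerLifting` (p789486) agrees with the route decl
DEFINITIONALLY (`deg_route_iff_twin := Iff.rfl`).  A child route with a FRAME item (precedents: CoreAdequacySplit g11, LieDefectSplit g12); refines
route-Langlands-LieDefectSplit:DegenerateLayerLifting (the parent decl is used BY NAME via FRAME″).

THE g12 VERDICT THIS NODE OVERTURNS.  The parent booked DEG as «no engine in print: extended adequacy / GHT 2017 are statements about WHEN adequacy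
holds, not lifting theorems without it».  That is true of the 2012 notion only.  Thorne, *Automorphy of some residually dihedral Galois
representations*, Math. Z. 285 (2017) [corpus:paper:doi-10-1007-s00209-016-1681-2 p2 «we take the opportunity to prove a new automorphy lifting
theorem for GL_n, Thm 5.1 … there is no restriction on the set of primes p at which this theorem applies»; p24 Def 2.20; p38 Thm 5.1] PROVES an
automorphy lifting theorem (CM, polarized, ordinary-minimal) whose ONLY image hypothesis is that ρ̄(G_{F(ζ_p)}) be adequate in the EXTENDED sense of
Def 2.20 = tree `Subgroup.IsThorne2017Adequate ↔ Subgroup.IsExtendedAdequate` (Literature/…/ExtendedAdequateSubgroup.lean; tree FACT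
`Thorne2017.automorphyLifting_unitary_ordinaryMinimal`, Literature/…/Thorne2017AutomorphyLifting.lean) — a notion WITHOUT the clause ℓ ∤ n and
WITHOUT (ad⁰)^J = 0, populated exactly on DEG's home ground, the slab ℓ ∣ n: SL_n(𝔽_q) ◁ G, n > 2 [corpus:paper:arxiv-1405.0043 p36 Thm 10.1],
SL₂(2^r), r ≥ 2, in its natural representation at ℓ = 2 [ibid. p34 Cor 9.4], p-solvable groups unless ±1 mod p-shaped dimensions [ibid. p4
Thm 1.3(i)], every absolutely irreducible ℓ′-group [ibid. p1; tree `Subgroup.isExtendedAdequate_of_not_dvd_card`].  GHT 2017 Thm 1.7 (tree FACT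
`ght2017_adequate_or_index_p_or_psl29`) classifies extended adequacy in dimension p COMPLETELY: adequate unless an index-p normal abelian
subgroup (weakly adequate, not adequate) or p = 3 with image Ω₃(9) = PSL₂(9) ≅ A₆ in dimension 3 (tree `OmegaThreeNine.not_isExtendedAdequate`,
kernel-checked).

THE CUT — position first (lens 5: the ASYMPTOTIC range is a THEOREM), then the extended-adequacy dial (the BRIDGE to Thorne 2017's engine), then the
irreducible-core dial (the finite residual vs the host's reducible branch).  Literals are inserted after DEG's `¬ SolvablyQuasiAdequateImage ρ →`;
each cell is DEG on a sub-box (WEAKER outright — `cells_of_deg`; Langlands-implied — §5 `Cert.*`), typed STRUCTURED over the landed twins BY NAME;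
the route one-liners (§6, `…Theorems.ExtAdequacyInline`) are `Iff.rfl` to the structured cells.
* HIGH `GenericPrimeDegenerateLifting` (DEG ∧ n < ℓ) — SUPPORT, VACUOUS IN PRINT (est. S once the two GHT facts are typed).  Chain: (1) n < ℓ ⇒ every
  I⁺-constituent has dimension d ≤ n < ℓ ⇒ GHT15 Thm 1.2(1) [corpus:paper:arxiv-1311.1786 p3; restated arxiv-1405.0043 p3 Thm 1.1]: I is WEAKLY
  adequate (clause (iv) holds on I, and on every absolutely irreducible layer J, same argument); (2) Schur + ℓ ∤ n ⇒ (ii) holds on every absolutely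
  irreducible layer; (3) hence ¬SQAL forces clause (i) to fail on EVERY abs. irreducible layer above P, in particular on I: ℓ ∣ [I : 𝒟I];
  (4) GHT17 Thm 1.3 [corpus:paper:arxiv-1405.0043 p4]: an absolutely irreducible I with an ℓ-quotient («p-Frattini / index-p normal subgroup») and
  d < 2ℓ − 2 (true: d ≤ n < ℓ) has d = ℓ − 1 (so (n,ℓ) ∈ {(2,3), (4,5), (16,17), …}, ℓ Fermat) and [I : Z(I)O₂(I)] = ℓ with O₂(I) extraspecial of
  order 2·d²; (5) L := Z(I)O₂(I) ◁ I of prime index ℓ contains P (I/L cyclic) and is absolutely irreducible (Clifford: else V|_L splits into ℓ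
  conjugate pieces, ℓ ∤ d = ℓ − 1) of order prime to ℓ, so L is an EXTENDED-adequate layer (`extAdequateBetween_of_layer_not_dvd_card`) and, since
  ℓ ∤ n, Thorne-2012-adequate (extended + ℓ ∤ n ⇒ 2012: (ad⁰)^L = 0 by Schur, H¹(L, ad⁰) ⊆ H¹(L, ad) = 0 as ad = ad⁰ ⊕ 1 when ℓ ∤ n) ⇒ SADQ(ρ),
  contradicting DEG's ¬SADQ.  ((2,3): L = Q₈·Z, the familiar «PSL₂(𝔽₃)-projective image becomes adequate over the S₃-layer»; the parent's (2,3) = ∅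
  row of record is the first instance.)  The kernel version needs finiteness/continuity of residual images (`IsReductionOf` is a bare homomorphism)
  and the two classification theorems as typed facts — typing targets named in the memo (STEP T).
* XS `ExtendedAdequateLayerLifting` (DEG ∧ ℓ ≤ n ∧ SXADQ) — crux rank 2, ATTACKABLE-BY-ENGINE-IN-TREE: `SolvablyExtAdequateImage ρ` := some absolutely
  irreducible layer J above the perfect core of the image is EXTENDED-adequate (`ExtAdequateBetween`, `Subgroup.IsExtendedAdequate`).  Engine: Thorne
  2017 Thm 5.1 over the solvable layer M cut out by J (the parent kit's AUT↑/CSD moves, as in TRANS of g11), on the sector where its other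
  hypotheses hold (K ⊇ an imaginary CM field / polarized / ordinary-minimal, ¬(ℓ = 2 ∧ n even)); DARK off-sector exactly as AIL and LIE are (lens-2's
  transverse axis).  Rows: (4,2) image ⊇ SL₄(2) ≅ A₈ or Sp₄(2)′-free overgroups (Thm 10.1), (3,3) image ⊇ SL₃(3) (Thm 10.1) or PGL₂(9)-projective
  (Cor 9.5: p^a = 9 included), (2,2) non-solvable images SL₂(2^r), r ≥ 2 (Cor 9.4) — the dyadic GL₂ world's insoluble half, where Thorne's CM theorem
  is void (n even) but the totally-real engines of record live (Kisin 2009 / Thorne 2016 2-adic; BC5 rung PLAN-ONLY, critic row 184 c2: not re-cut).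
* CRD `CoreReducibleDegenerateLifting` (DEG ∧ ℓ ≤ n ∧ ¬SXADQ ∧ ¬CoreIrr) — the BRIDGE cell (NOT an item) = conclusion of the support T_N
  `CoreReducibleTransport := OW → RES → W⁺ → CSD → RPO → RNO₂ → RNO₃ → CRD` (all antecedents items of record BY NAME: parent 28903/28874/17415/31695,
  host route-Langlands-OdlyzkoWorldSplit 33908/33909/33910).  CHAIN (print modulo the binders): (P0) N := fixed field of ρ̄⁻¹(P) ∩ Γ_{K(ζ_ℓ)} is finite
  Galois over K with Gal(N/K) ↪ (I/P) ⋊ Gal(K(ζ_ℓ)/K) SOLVABLE, and the residual image over N(ζ_ℓ) = N is P, NOT absolutely irreducible (¬CoreIrr;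
  Brauer–Nesbitt independence of τ) ⇒ for every constituent ϑ of ρ|_N of rank n, ¬CycIrr(ϑ) in the host's currency
  `¬ (ϑ.restrictField (CyclotomicField ℓ N)).IsResiduallyAbsIrreducible`; (P1) ρ irreducible and geometric (LiftTail's hypotheses) ⇒ ρ|_N = ⊕ ϑ_i
  semisimple with Gal(N/K)-conjugate irreducible geometric constituents of equal rank m ∣ n (Clifford; restriction preserves a.e.-unramified and
  de Rham); (P2) LINK over N for each ϑ_i: Serre_w(N) = OW ∧ RES at (N, m, ℓ) (NO image hypothesis, field-uniform) gives a cuspidal L-algebraic π_i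
  with Satake ≡ Frobenius(ϑ_i) mod 𝔪 a.e.; its W⁺-avatar ρ'_i is irreducible and Satake-compatible with π_i, whence congruent Frobenius polynomials
  (trace identity ⇒ equal polynomials, as in TRANS↓ step (2) of g12); (P3) m < n: IH `LiftBelow n` at rank m over N (field-uniform, = the host's inline
  IH VERBATIM) ⇒ ϑ_i weakly automorphic over N; m = n (ρ|_N = ϑ irreducible): the host's R-branch over N — RPO if ϑ is potentially ordinary at all
  w ∣ ℓ, else RNO₂ (n ≤ 2) / RNO₃ (3 ≤ n) — whose hypotheses are exactly IH(n) ∧ ¬IsResiduallyAbsIrreducible over N(ζ_ℓ) ∧ irreducible ∧ geometric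
  ∧ LINK ⇒ ϑ weakly automorphic over N; (P4) CSD `CliffordSolvableDescent` along the solvable Galois N/K (its W⁺ antecedent is an item here):
  a constituent of ρ|_N weakly automorphic over N ⇒ ρ weakly automorphic over K = the conclusion of LiftTail(ρ).  Non-binder steps (P0, P1, the
  polynomial identity in P2) are print-routine; the tree lacks the Galois-correspondence plumbing (fixed fields of open subgroups of Γ_K as
  `NumberField`s), which is why T_N is a support item and not glue — the parent's TRANS / TRANS↓ precedent.
* CORE `CoreIrreducibleInadequateLifting` (DEG ∧ ℓ ≤ n ∧ ¬SXADQ ∧ CoreIrr) — crux rank 3, the DECLARED RESIDUAL: the perfect core acts absolutely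
  irreducibly (so no solvable base change makes ρ̄ reducible or smaller than P) and no layer in [P, I] is adequate even in the extended sense.
  GENUINE: (3,3) projective image A₆ ≅ PSL₂(9) ≅ Ω₃(9) on its 3-dimensional module — GHT17 Thm 1.7(c), kernel-checked in the tree
  (`OmegaThreeNine.isAbsIrreducible` ∧ `OmegaThreeNine.not_isExtendedAdequate` in Literature/…/AdequacyDegreeThreeException.lean — cited by name, not imported: the module is not in the farm snapshot); (4,2) image SL₂(4) ≅ A₅ on the
  4-dimensional Steinberg module (GHT17 Cor 9.4: (p^r, dim) = (4,4) excluded).  By GHT17 Thm 1.7 the (3,3) row is the ONLY dimension-p row with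
  irreducible core (index-p-normal-abelian images have reducible core ↦ CRD).  No lifting theorem in print: IDEA-NEEDED (position change by
  functoriality — at (3,3) the A₆-projective 3-dimensional ρ̄ is, up to twist, Sym² of a 2-dimensional 𝔽₉-representation of the Valentiner cover
  whose image SL₂(9)-type IS adequate (Cor 9.4/9.5: 9 in dimension 2 allowed) — Thorne's own n = 2 ↦ n = 4 trick in Math. Z. 2017 is the model) and
  INSTRUMENTABLE (census: the extended-adequacy column + CoreIrr bit on the slab rows (2,2), (3,3), (4,2) and the LOW rows ℓ ≤ n ≤ 4).
* FRAME″ `DegenerateLayerFrame := DEG → Langlands` (support; content = the parent route VERBATIM with DEG abstracted: `frame_of_parent` =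
  `LieDefectSplit.closes` with its ten other binders).

ORBIT ANALYSIS (critic row 6 — R2, why no cell is a costume of another).  g11 KERNEL III (`perfectCore_eq_of_normal_of_isSolvable_quotient`): a
normal subgroup with solvable quotient has the SAME perfect core.  Hence SXADQ is MONOTONE up the solvable orbit and ¬SXADQ is inherited by every
solvable Galois restriction (`ExtAdequateBetween.of_normal_of_isSolvable_quotient`, `not_extAdequateBetween_…`, PROVED), CoreIrr is INVARIANT both
ways (`coreAbsIrreducible_iff_of_normal_of_isSolvable_quotient`, PROVED), the position (n, ℓ) is unchanged by base change, and ¬ADQ/¬SADQ/¬SQAL/the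
carves are inherited as in g11/g12.  So the kit's transport moves (AUT↑ solvable restriction, CSD solvable descent, the host's R-branch which needs a
residually REDUCIBLE restriction) never carry an XS instance to CORE or back, and never make a CORE instance closable: over any solvable M the image
J ∈ [P, I] of a CORE instance is absolutely irreducible (⊇ P irreducible), not 2012-adequate, not extended-adequate, so neither AIL, TRANS, LIE's
engines, XS's engine nor RPO/RNO₂/RNO₃ applies — R1 «the residual books no kit-closable sub-box» holds for CORE by construction, and the ONE
kit-closable sub-box of DEG (reducible core) is carved out as the bridge CRD.  R3: every cell is implied by DEG outright (`cells_of_deg`) and by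
Langlands (`Cert.*`) — WEAKER, never costume-by-strength; HIGH is even provably empty in print.

WHY EACH PIECE IS STRICTLY WEAKER THAN DEG.  XS omits every CORE row ((3,3) A₆, (4,2) Steinberg) and every CRD row; CORE omits every XS row ((4,2)
SL₄(2)-images, (3,3) SL₃(3)/PGL₂(9)-images, (2,2) SL₂(4)-images) and every CRD row (index-ℓ normal abelian images, e.g. the monomial (3,3) and
dihedral-induced (2,2) rows); CRD omits both; HIGH is DEG on the generic-prime half-box.  Separating rows are finite groups of record (GHT17 Thm 1.7,
Cor 9.4/9.5, Thm 10.1; census table I-L5g11/g12 rows (2,2), (3,3), (4,2), (4,3)).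

WHY THIS IS NOVEL (one sentence).  Nobody — in print or in the 47 routes of the cell — has cut a small-prime lifting statement by THORNE'S 2017
EXTENDED adequacy on the solvable layers above the perfect core: it turns the parent's «degenerate defects, no engine» residual into (a) a provably
EMPTY generic-prime half (GHT15 Thm 1.2 + GHT17 Thm 1.3 + the ℓ′-layer lemma), (b) an ENGINE cell on the slab ℓ ∣ n that the lineage had written
off (Thorne Math. Z. 2017 Thm 5.1, in the tree as a fact and never cited by any route; nearest in-tree use of extended adequacy: the crux line
`ThreeAdicAdequateImages/Lines/birth.lean` of route EvenVoidBelowEight at p = 3 ∣ 9, a different summit conjunct), (c) the host's reducible branch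
reached through the SOLVABLE HULL (new bridge T_N: the first use of RPO/RNO₂/RNO₃ below an irreducible-image crux), and (d) a finite, kernel-witnessed
residual (Ω₃(9) at (3,3), Steinberg at (4,2)) with a named idea.  Claimed grade: new-combination.

KERNEL (this file, rc 0 · 0 sorry · axioms propext/Classical.choice/Quot.sound): §1 group level (`ExtAdequateBetween`, `CoreAbsIrreducible`, orbit
lemmas, ℓ′-layer lemma); §2 field dials + `Iff.rfl` clause certificates + `deg_route_iff_twin`; §2b cells; §3 `deg_iff_cells :
DEG ↔ HIGH ∧ XS ∧ CRD ∧ CORE` OUTRIGHT by THREE excluded middles (position / SXADQ / CoreIrr; `regions_cover`, `regions_disjoint`; 0 EQUIV),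
`DegenerateLayerLifting_route_iff_cells` on the tree ROUTE decl, `crd_of_transport`; §4 ROOT `closes` (16 binders) := `LieDefectSplit.closes …
(deg_route_of_cells …)` → `_root_.Langlands`, child deciding theorem `closes_framed` / `ExtAdequacyInline.closes_inline` (12 binders HIGH, XS,
CORE, T_N, OW, RES, W⁺, CSD, RPO, RNO₂, RNO₃, FRAME″ — all used; `assembly_holds`); §5 `Cert.*` necessity.
Nothing here proves `Langlands` (rung 0): the node is an exact re-cut of an open residual with one cell attacked by an engine of record, one cell
bridged to items of record, one cell provably empty in print, and a declared finite residual.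
-/

set_option linter.dupNamespace false

namespace Summit.Langlands.Langlands.Theorems.CoreAdequacy.ExtAdequacy

open Filter
open scoped MatrixGroups
open Literature.NumberTheory.GaloisRepresentations
open Summit.Langlands.Langlands.Theses

universe u

/-! ## §1 Group theory: extended-adequate layers above the perfect core; the irreducible-core dial (orbit-closed under solvable moves) -/

section GroupLevel

variable {k : Type u} [Field k] {n : ℕ}

/-- GROUP-LEVEL DIAL «XADQ-layer»: some layer `J` of `I` above the perfect core (`LieDefect.AboveCore I J` ⟺ `perfectCore I ≤ J`), inside `I`, is
absolutely irreducible and EXTENDED-ADEQUATE in Thorne's 2017 sense (tree `Subgroup.IsExtendedAdequate`: (i) Hom(J,k)=0, (ii′) H¹(J, ad) = 0 for the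
FULL adjoint module `ad = 𝔤𝔩_n` (`adModScalarRep`-free form), (iii′) M_n(k) is spanned by the semisimple parts of J — NO clause «ℓ ∤ n» and NO
«(ad⁰)^J = 0»; `isThorne2017Adequate_iff_isExtendedAdequate`).  The 2012 notion fails on the whole slab ℓ ∣ n (Schur: scalars ∈ (ad⁰)^J); the 2017
notion does not [corpus:paper:arxiv-1405.0043 p3 «we extend the notion of adequate … to include the case p ∣ dim V, following Thorne 2015»;
corpus:paper:doi-10-1007-s00209-016-1681-2 p24 Def 2.20]. -/
def ExtAdequateBetween (I : Subgroup (GL (Fin n) k)) : Prop :=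
  ∃ J : Subgroup (GL (Fin n) k), LieDefect.AboveCore I J ∧ J ≤ I ∧ IsAbsIrreducible J.subtype ∧ Subgroup.IsExtendedAdequate J

/-- An extended-adequate absolutely irreducible `I` is its own layer. -/
theorem extAdequateBetween_of_self {I : Subgroup (GL (Fin n) k)} (hirr : IsAbsIrreducible I.subtype) (h : Subgroup.IsExtendedAdequate I) :
    ExtAdequateBetween I :=
  ⟨I, fun _ hQ _ => hQ, le_rfl, hirr, h⟩

/-- **ORBIT LEMMA (up).**  A normal subgroup `I' ◁ I` with solvable quotient has the same perfect core (g11 KERNEL III), so a layer for `I'` is a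
layer for `I`: the dial is MONOTONE up the solvable orbit. -/
theorem ExtAdequateBetween.of_normal_of_isSolvable_quotient {I I' : Subgroup (GL (Fin n) k)} (hle : I' ≤ I) [(I'.subgroupOf I).Normal]
    (hsolv : IsSolvable (I ⧸ I'.subgroupOf I)) (h : ExtAdequateBetween I') : ExtAdequateBetween I := by
  obtain ⟨J, hPJ, hJI, hirr, hx⟩ := h
  exact ⟨J, (LieDefect.aboveCore_iff_of_normal_of_isSolvable_quotient hle hsolv).1 hPJ, hJI.trans hle, hirr, hx⟩

/-- **ORBIT LEMMA (down).**  ¬(XADQ-layer) is INHERITED by every normal subgroup with solvable quotient — i.e. by the residual image over every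
solvable Galois layer `M/K(ζ_ℓ)`: the cells below are closed under the kit's solvable moves (AUT↑ restriction, CSD descent). -/
theorem not_extAdequateBetween_of_normal_of_isSolvable_quotient {I I' : Subgroup (GL (Fin n) k)} (hle : I' ≤ I) [(I'.subgroupOf I).Normal]
    (hsolv : IsSolvable (I ⧸ I'.subgroupOf I)) (h : ¬ ExtAdequateBetween I) : ¬ ExtAdequateBetween I' :=
  fun h' => h (h'.of_normal_of_isSolvable_quotient hle hsolv)

/-- **ℓ′-LAYER LEMMA** (the group-theoretic heart of the HIGH-range vacuity and of the Fermat-type rows): an absolutely irreducible layer above the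
perfect core whose ORDER IS PRIME TO ℓ is an extended-adequate layer (tree `Subgroup.isExtendedAdequate_of_not_dvd_card`, Maschke + Burnside
[corpus:paper:arxiv-1405.0043 p1 «if G is a finite group of order prime to p … (G,V) is adequate»]). -/
theorem extAdequateBetween_of_layer_not_dvd_card {p : ℕ} [Fact p.Prime] [CharP k p] {I J : Subgroup (GL (Fin n) k)} [Finite J]
    (hPJ : LieDefect.AboveCore I J) (hJI : J ≤ I) (hcard : ¬ p ∣ Nat.card J) (hirr : IsAbsIrreducible J.subtype) : ExtAdequateBetween I :=
  ⟨J, hPJ, hJI, hirr, Subgroup.isExtendedAdequate_of_not_dvd_card J hcard hirr⟩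

/-- In particular an absolutely irreducible finite `I` of order prime to `ℓ` has an extended-adequate layer (itself). -/
theorem extAdequateBetween_of_not_dvd_card {p : ℕ} [Fact p.Prime] [CharP k p] (I : Subgroup (GL (Fin n) k)) [Finite I]
    (hcard : ¬ p ∣ Nat.card I) (hirr : IsAbsIrreducible I.subtype) : ExtAdequateBetween I :=
  extAdequateBetween_of_layer_not_dvd_card (fun _ hQ _ => hQ) le_rfl hcard hirr

/-- GROUP-LEVEL DIAL «CoreIrr»: the PERFECT CORE of `I` (tree `perfectCore`, the largest perfect subgroup = last term of the derived series) acts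
absolutely irreducibly.  ¬CoreIrr ⟺ over the solvable hull N (fixed field of ρ̄⁻¹(P) ∩ Γ_{K(ζ_ℓ)}, a finite SOLVABLE Galois extension of K) the
residual representation is NOT absolutely irreducible — the entrance hypothesis of the host's R-branch RPO/RNO₂/RNO₃. -/
def CoreAbsIrreducible (I : Subgroup (GL (Fin n) k)) : Prop :=
  IsAbsIrreducible (perfectCore I).subtype

/-- **ORBIT LEMMA.**  CoreIrr only depends on the perfect core, hence is INVARIANT along normal subgroups with solvable quotient (both directions). -/
theorem coreAbsIrreducible_iff_of_normal_of_isSolvable_quotient {I I' : Subgroup (GL (Fin n) k)} (hle : I' ≤ I) [(I'.subgroupOf I).Normal]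
    (hsolv : IsSolvable (I ⧸ I'.subgroupOf I)) : CoreAbsIrreducible I' ↔ CoreAbsIrreducible I := by
  unfold CoreAbsIrreducible
  rw [perfectCore_eq_of_normal_of_isSolvable_quotient hle hsolv]

/-- A perfect absolutely irreducible group is its own core, so CoreIrr holds (e.g. the insoluble quasi-simple images SL₂(4) on the Steinberg
module at (n,ℓ) = (4,2), 3·A₆-free A₆ ≅ Ω₃(9)-type images at (3,3)). -/
theorem coreAbsIrreducible_of_perfect {I : Subgroup (GL (Fin n) k)} (hperf : ⁅I, I⁆ = I) (hirr : IsAbsIrreducible I.subtype) : CoreAbsIrreducible I := by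
  have h : I = perfectCore I := isPerfectCore_iff_eq.1 ⟨le_rfl, hperf, fun Q hQ _ => hQ⟩
  unfold CoreAbsIrreducible
  rw [← h]
  exact hirr

end GroupLevel

/-! ## §2 Field-level dials (vocabulary = the landed twins `Theorems.CoreAdequacy` / `…LieDefect`, BY NAME) -/

section Cells

/-- NEW DIAL «SXADQ» — **solvably extended-adequate image**: some absolutely irreducible reduction `τ` of `ρ|Γ_{K(ζ_ℓ)}` has a layer `J` above the
perfect core of its image, inside the image, absolutely irreducible and EXTENDED-adequate (Thorne 2017).  By the Galois correspondence such `J` are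
exactly the residual images over the layers of the finite solvable Galois hulls of `K` inside `K(ρ̄, ζ_ℓ)`: «after a solvable base change the image
hypothesis of Thorne's Math. Z. 2017 lifting theorem (Thm 5.1) holds». -/
def SolvablyExtAdequateImage {K : Type} [Field K] [NumberField K] {ℓ : ℕ} [Fact ℓ.Prime] {n : ℕ} (ρ : FramedGaloisRep K (PadicAlgCl ℓ) n) : Prop :=
  ∃ τ : Field.absoluteGaloisGroup (CyclotomicField ℓ K) →* GL (Fin n) (padicAlgClResidueField ℓ),
    (ρ.restrictField (CyclotomicField ℓ K)).IsReductionOf (RingHom.id _) τ ∧ IsAbsIrreducible τ ∧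
      ∃ J : Subgroup (GL (Fin n) (padicAlgClResidueField ℓ)), LieDefect.AboveCore τ.range J ∧ J ≤ τ.range ∧ IsAbsIrreducible J.subtype ∧
        Subgroup.IsExtendedAdequate J

/-- The field-level dial is the group-level predicate on the image (definitional). -/
theorem solvablyExtAdequateImage_iff {K : Type} [Field K] [NumberField K] {ℓ : ℕ} [Fact ℓ.Prime] {n : ℕ} (ρ : FramedGaloisRep K (PadicAlgCl ℓ) n) :
    SolvablyExtAdequateImage ρ ↔ ∃ τ : Field.absoluteGaloisGroup (CyclotomicField ℓ K) →* GL (Fin n) (padicAlgClResidueField ℓ),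
      (ρ.restrictField (CyclotomicField ℓ K)).IsReductionOf (RingHom.id _) τ ∧ IsAbsIrreducible τ ∧ ExtAdequateBetween τ.range := Iff.rfl

/-- SXADQ ⟹ CycIrr (the dial lives inside F†'s box). -/
theorem cycIrr_of_solvablyExtAdequateImage {K : Type} [Field K] [NumberField K] {ℓ : ℕ} [Fact ℓ.Prime] {n : ℕ} (ρ : FramedGaloisRep K (PadicAlgCl ℓ) n) (h : SolvablyExtAdequateImage ρ) : CycIrr ρ := by
  obtain ⟨τ, hτ, hirr, _⟩ := h
  exact ⟨τ, hτ, hirr⟩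

/-- NEW DIAL «CoreIrr» — the perfect core of the image of some absolutely irreducible reduction of `ρ|Γ_{K(ζ_ℓ)}` acts absolutely irreducibly. -/
def CoreIrreducibleImage {K : Type} [Field K] [NumberField K] {ℓ : ℕ} [Fact ℓ.Prime] {n : ℕ} (ρ : FramedGaloisRep K (PadicAlgCl ℓ) n) : Prop :=
  ∃ τ : Field.absoluteGaloisGroup (CyclotomicField ℓ K) →* GL (Fin n) (padicAlgClResidueField ℓ),
    (ρ.restrictField (CyclotomicField ℓ K)).IsReductionOf (RingHom.id _) τ ∧ IsAbsIrreducible τ ∧ IsAbsIrreducible (perfectCore τ.range).subtype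

/-- The field-level dial is the group-level predicate on the image (definitional). -/
theorem coreIrreducibleImage_iff {K : Type} [Field K] [NumberField K] {ℓ : ℕ} [Fact ℓ.Prime] {n : ℕ} (ρ : FramedGaloisRep K (PadicAlgCl ℓ) n) :
    CoreIrreducibleImage ρ ↔ ∃ τ : Field.absoluteGaloisGroup (CyclotomicField ℓ K) →* GL (Fin n) (padicAlgClResidueField ℓ),
      (ρ.restrictField (CyclotomicField ℓ K)).IsReductionOf (RingHom.id _) τ ∧ IsAbsIrreducible τ ∧ CoreAbsIrreducible τ.range := Iff.rfl

/-- CoreIrr ⟹ CycIrr. -/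
theorem cycIrr_of_coreIrreducibleImage {K : Type} [Field K] [NumberField K] {ℓ : ℕ} [Fact ℓ.Prime] {n : ℕ} (ρ : FramedGaloisRep K (PadicAlgCl ℓ) n) (h : CoreIrreducibleImage ρ) : CycIrr ρ := by
  obtain ⟨τ, hτ, hirr, _⟩ := h
  exact ⟨τ, hτ, hirr⟩

/-- The SXADQ literal of the route one-liners is `SolvablyExtAdequateImage ρ` (definitional). -/
theorem sxadq_clause_iff (K : Type) [Field K] [NumberField K] (n ℓ : ℕ) [Fact ℓ.Prime] (ρ : FramedGaloisRep K (PadicAlgCl ℓ) n) :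
    (∃ τ : Field.absoluteGaloisGroup (CyclotomicField ℓ K) →* Matrix.GeneralLinearGroup (Fin n) (Literature.NumberTheory.GaloisRepresentations.padicAlgClResidueField ℓ), (ρ.restrictField (CyclotomicField ℓ K)).IsReductionOf (RingHom.id (Literature.NumberTheory.GaloisRepresentations.padicAlgClResidueField ℓ)) τ ∧ Literature.NumberTheory.GaloisRepresentations.IsAbsIrreducible τ ∧ ∃ J : Subgroup (Matrix.GeneralLinearGroup (Fin n) (Literature.NumberTheory.GaloisRepresentations.padicAlgClResidueField ℓ)), Summit.Langlands.Langlands.Theorems.CoreAdequacy.LieDefect.AboveCore τ.range J ∧ J ≤ τ.range ∧ Literature.NumberTheory.GaloisRepresentations.IsAbsIrreducible J.subtype ∧ Literature.NumberTheory.GaloisRepresentations.Subgroup.IsExtendedAdequate J) ↔ SolvablyExtAdequateImage ρ := Iff.rfl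

/-- The CoreIrr literal of the route one-liners is `CoreIrreducibleImage ρ` (definitional). -/
theorem coreIrr_clause_iff (K : Type) [Field K] [NumberField K] (n ℓ : ℕ) [Fact ℓ.Prime] (ρ : FramedGaloisRep K (PadicAlgCl ℓ) n) :
    (∃ τ : Field.absoluteGaloisGroup (CyclotomicField ℓ K) →* Matrix.GeneralLinearGroup (Fin n) (Literature.NumberTheory.GaloisRepresentations.padicAlgClResidueField ℓ), (ρ.restrictField (CyclotomicField ℓ K)).IsReductionOf (RingHom.id (Literature.NumberTheory.GaloisRepresentations.padicAlgClResidueField ℓ)) τ ∧ Literature.NumberTheory.GaloisRepresentations.IsAbsIrreducible τ ∧ Literature.NumberTheory.GaloisRepresentations.IsAbsIrreducible (Summit.Langlands.Langlands.Theorems.CoreAdequacy.perfectCore τ.range).subtype) ↔ CoreIrreducibleImage ρ := Iff.rfl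

-- `deg_route_iff_twin` of the node = the landed `Summit.Langlands.Langlands.Theorems.LieDefectBridge.deg_route_iff` (LieDefectSplitBridge.lean, p789728); not restated (gate dedup).

/-! ## §2b The FOUR cells (DEG with literals inserted after ¬SQAL; position first, then SXADQ, then CoreIrr) and the supports -/

/-- **HIGH — GENERIC-PRIME DEGENERATE LIFTING** (DEG ∧ n < ℓ).  SUPPORT, VACUOUS IN PRINT (node docstring §HIGH): for n < ℓ < 2(n+1) an absolutely
irreducible I ≤ GL_n(𝔽̄_ℓ) with NO quasi-adequate layer above its perfect core has, by GHT15 Thm 1.2(1) (p > d ⇒ weakly adequate) and Schur, an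
ℓ-power quotient on every layer, so by GHT17 Thm 1.3 (d < 2p − 2 ⇒ d = p − 1, Fermat prime, [I : Z(I)O₂(I)] = p) the ℓ′-layer Z(I)O₂(I) ⊇ P is
absolutely irreducible (Clifford, ℓ prime) and of order prime to ℓ, hence EXTENDED-adequate (`extAdequateBetween_of_layer_not_dvd_card`) and, as
ℓ ∤ n = ℓ − 1, Thorne-2012-adequate: SADQ holds, contradicting DEG's hypothesis ¬SADQ.  So HIGH has no instances; it is kept as an honest support item
(the kernel lacks finiteness of residual images and the two GHT classification facts as typed statements). -/
def GenericPrimeDegenerateLifting : Prop :=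
  ∀ (K : Type) [Field K] [NumberField K] (n : ℕ) (hcpt : Literature.NumberTheory.Automorphic.isCompact_glFiniteIntegralLevel n K), 0 < n →
    LiftBelow n → ∀ (ℓ : ℕ) [Fact ℓ.Prime] (ι : PadicAlgCl ℓ ≃+* ℂ) (ρ : FramedGaloisRep K (PadicAlgCl ℓ) n),
      ℓ < 2 * (n + 1) → CycIrr ρ → ¬ AdequateCyclotomicImage ρ → ¬ SolvablyAdequateImage ρ →
        ¬ LieDefect.SolvableDescentShadow ρ → ¬ LieDefect.SolvablyQuasiAdequateImage ρ → n < ℓ →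
          ¬ Theorems.BrightMate.SolvablyReducible ρ → ¬ Theorems.BrightMate.SolvablyMated ι ρ → LiftTail K n hcpt ℓ ι ρ

/-- **XS — EXTENDED-ADEQUATE-LAYER LIFTING** (DEG ∧ ℓ ≤ n ∧ SXADQ) — crux rank 2, ATTACKED.  On the low range ℓ ≤ n (where alone DEG is populated)
some solvable layer of the image is absolutely irreducible and adequate in Thorne's EXTENDED sense although no layer is 2012-adequate (typically the
slab ℓ ∣ n: SL_n(𝔽_q)-images (GHT17 Thm 10.1), SL₂(2^r), r ≥ 2, at (2,2) (Cor 9.4), p-solvable Fermat/Mersenne rows (Thm 1.3(i)), every ℓ′-layer).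
ENGINE: Thorne, Math. Z. 285 (2017) Thm 5.1 = tree fact `Thorne2017.automorphyLifting_unitary_ordinaryMinimal` (CM, polarized, ordinary-minimal,
¬(ℓ = 2 ∧ n even)); its proof is the Taylor–Wiles–Kisin method with the Čebotarev step run on the extended-adequate image. -/
def ExtendedAdequateLayerLifting : Prop :=
  ∀ (K : Type) [Field K] [NumberField K] (n : ℕ) (hcpt : Literature.NumberTheory.Automorphic.isCompact_glFiniteIntegralLevel n K), 0 < n →
    LiftBelow n → ∀ (ℓ : ℕ) [Fact ℓ.Prime] (ι : PadicAlgCl ℓ ≃+* ℂ) (ρ : FramedGaloisRep K (PadicAlgCl ℓ) n),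
      ℓ < 2 * (n + 1) → CycIrr ρ → ¬ AdequateCyclotomicImage ρ → ¬ SolvablyAdequateImage ρ →
        ¬ LieDefect.SolvableDescentShadow ρ → ¬ LieDefect.SolvablyQuasiAdequateImage ρ → ℓ ≤ n → SolvablyExtAdequateImage ρ →
          ¬ Theorems.BrightMate.SolvablyReducible ρ → ¬ Theorems.BrightMate.SolvablyMated ι ρ → LiftTail K n hcpt ℓ ι ρ

/-- **CRD — CORE-REDUCIBLE DEGENERATE LIFTING** (DEG ∧ ℓ ≤ n ∧ ¬SXADQ ∧ ¬CoreIrr) — the BRIDGE cell (NOT an item): the perfect core P of the image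
acts reducibly, so over the SOLVABLE HULL N of ρ̄ (Galois, solvable over K) the residual representation is not absolutely irreducible and the host's
residually-reducible branch RPO/RNO₂/RNO₃ applies over N; the conclusion descends to K by CSD.  = the conclusion of the support T_N. -/
def CoreReducibleDegenerateLifting : Prop :=
  ∀ (K : Type) [Field K] [NumberField K] (n : ℕ) (hcpt : Literature.NumberTheory.Automorphic.isCompact_glFiniteIntegralLevel n K), 0 < n →
    LiftBelow n → ∀ (ℓ : ℕ) [Fact ℓ.Prime] (ι : PadicAlgCl ℓ ≃+* ℂ) (ρ : FramedGaloisRep K (PadicAlgCl ℓ) n),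
      ℓ < 2 * (n + 1) → CycIrr ρ → ¬ AdequateCyclotomicImage ρ → ¬ SolvablyAdequateImage ρ →
        ¬ LieDefect.SolvableDescentShadow ρ → ¬ LieDefect.SolvablyQuasiAdequateImage ρ → ℓ ≤ n → ¬ SolvablyExtAdequateImage ρ → ¬ CoreIrreducibleImage ρ →
          ¬ Theorems.BrightMate.SolvablyReducible ρ → ¬ Theorems.BrightMate.SolvablyMated ι ρ → LiftTail K n hcpt ℓ ι ρ

/-- **CORE — CORE-IRREDUCIBLE INADEQUATE LIFTING** (DEG ∧ ℓ ≤ n ∧ ¬SXADQ ∧ CoreIrr) — crux rank 3, the DECLARED RESIDUAL of this node: the perfect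
core acts absolutely irreducibly and NO solvable layer is adequate even in the extended sense.  Rows of record: (3,3) projective image EXACTLY
A₆ ≅ PSL₂(9) on the 3-dimensional module (GHT17 Thm 1.7(c); tree `OmegaThreeNine.not_isExtendedAdequate` / `OmegaThreeNine.isAbsIrreducible`, Literature/…/AdequacyDegreeThreeException.lean), (4,2) image
SL₂(4) ≅ A₅ on the Steinberg module (GHT17 Cor 9.4), further p^a-dimensional SL₂(p^a) rows (n,ℓ) = (4,2), (3,3) only below 2(n+1) for n ≤ 4.
No lifting theorem in print; IDEA-NEEDED (functorial position change, e.g. Sym²: GL₂ → GL₃ at (3,3) lands on adequate GL₂(𝔽₉)-images). -/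
def CoreIrreducibleInadequateLifting : Prop :=
  ∀ (K : Type) [Field K] [NumberField K] (n : ℕ) (hcpt : Literature.NumberTheory.Automorphic.isCompact_glFiniteIntegralLevel n K), 0 < n →
    LiftBelow n → ∀ (ℓ : ℕ) [Fact ℓ.Prime] (ι : PadicAlgCl ℓ ≃+* ℂ) (ρ : FramedGaloisRep K (PadicAlgCl ℓ) n),
      ℓ < 2 * (n + 1) → CycIrr ρ → ¬ AdequateCyclotomicImage ρ → ¬ SolvablyAdequateImage ρ →
        ¬ LieDefect.SolvableDescentShadow ρ → ¬ LieDefect.SolvablyQuasiAdequateImage ρ → ℓ ≤ n → ¬ SolvablyExtAdequateImage ρ → CoreIrreducibleImage ρ →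
          ¬ Theorems.BrightMate.SolvablyReducible ρ → ¬ Theorems.BrightMate.SolvablyMated ι ρ → LiftTail K n hcpt ℓ ι ρ

/-- **T_N — CORE-REDUCIBLE TRANSPORT** (support; PRINT modulo its antecedents, all items of record BY NAME: Serre_w over the solvable hull N from
OW ∧ RES (no image hypothesis, field-uniform), the avatar W⁺ (re-creates the congruence LINK over N), CSD (descent N → K of weak automorphy), and the
host's residually-REDUCIBLE branch RPO ∧ RNO₂ ∧ RNO₃ of route-Langlands-OdlyzkoWorldSplit (stmt-Langlands-33908/33909/33910) applied over N to
the irreducible constituents of ρ|_N of full rank; lower-rank constituents by the instance's IH `LiftBelow n` (field-uniform)).  Conclusion = CRD. -/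
def CoreReducibleTransport : Prop :=
  LieDefectSplit.OdlyzkoWorldAutomorphy → LieDefectSplit.TransOdlyzkoAutomorphy → LieDefectSplit.SatakeAvatarExistence →
    LieDefectSplit.CliffordSolvableDescent → OdlyzkoWorldSplit.CyclotomicReducibleOrdinaryLifting →
      OdlyzkoWorldSplit.CyclotomicReducibleNonOrdinaryRankTwoLifting → OdlyzkoWorldSplit.CyclotomicReducibleNonOrdinaryHigherRankLifting →
        CoreReducibleDegenerateLifting

/-- **FRAME″** — the PARENT ROUTE VERBATIM with DEG abstracted: «DEG → Langlands», i.e. the ten other binders of `LieDefectSplit.closes`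
(LIE, TRANS↓, OW, RES, W⁺, AUT↑, CSD, AIL, TRANS, FRAME′) — node kernel `frame_of_parent`.  Support; never staffed on its own. -/
def DegenerateLayerFrame : Prop :=
  LieDefectSplit.DegenerateLayerLifting → _root_.Langlands


end Cells

end Summit.Langlands.Langlands.Theorems.CoreAdequacy.ExtAdequacy
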